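import Literature.Geometry.Lorentzian.HypersurfaceDevelopmentGluing
import Literature.Geometry.Lorentzian.HypersurfaceCorrespondingBoundary
import Literature.Geometry.Lorentzian.CauchyProblemMGHDExistence
import Literature.Geometry.Lorentzian.CauchyDevelopmentCausal
import Literature.Geometry.Lorentzian.TimelikeCurveLiftLocal
import Summits.FinalStateConjecture.FinalStateConjecture.Theorems.PhaseMixingCaptureCaptureSufficesC2StubHypersurfaceMGHDRealisedRealise
import Summits.FinalStateConjecture.FinalStateConjecture.Theorems.SwallowTheDatumSubdataDevelopmentsEmbed
import HarnessLib

/-!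
# Crux `CaptureSufficesC2` (stmt-FinalStateConjecture-14986), line `Sketch` — stub
# `stub_hypersurfaceMGHDRealised` (S2), part 2: the stub from Choquet-Bruhat–Geroch existence and
# the domain of dependence of an acausal hypersurface

**Stub S2** (hypersurface sub-data maximality, realised form): for a MAXIMAL vacuum Cauchy
development `𝓜` of data on `X` and a smooth embedding `j : N → 𝓜` with future unit normal `ν`
inducing the data `D'` on `N`, with `j(N)` ACAUSAL in `𝓜`, the datum `D'` has a maximal vacuum
Cauchy development `𝒟'` realised inside `𝓜` by a smooth, isometric, time-orientation preserving
open embedding `χ` with `χ ∘ ι' = j` (Choquet-Bruhat–Geroch 1969, Thm. 3 and p. 334;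
Hawking–Ellis 1973, §7.6, pp. 249–251, relative to a spacelike hypersurface `𝓗` of a development).

This file proves the stub CONDITIONALLY on two displayed hypotheses:

* the named fact `Literature.Geometry.Lorentzian.choquetBruhat_geroch_exists_mghd_cauchy`
  (existence of the MGHD of smooth vacuum data; unproved in the tree, taken by name), and
* **(DoD)** the domain-of-dependence statement for an acausal spacelike hypersurface `S = j(N)`
  of a Cauchy development `𝓜` (O'Neill 1983, Def. 14.35 and Lemma 14.43; Hawking–Ellis 1973,
  Prop. 6.6.3, 6.6.7): there is an open connected `W ⊇ S` in which `S` is a Cauchy hypersurface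
  and which contains every point `q ∈ I±(S)` all of whose past/future-endless causal curves meet
  `S` — displayed inline as a `∀`-statement over vacuum Cauchy developments (the registered
  sub-goal `stub_hypersurfaceMGHDRealised_of_dodRegion`; the W-pointwise form is
  `HypersurfaceMGHDRealised.realised_of_region`).

**Proof** (the hypersurface form of the localisation argument of item 10053,
`SubdataDevelopmentsEmbed.subdataDevelopmentsEmbed_of_choquetBruhatGeroch_of_causalCompact`).
`N` is Hausdorff and second countable (embedded in `𝓜`). The region `W` of (DoD), with the
structures of `𝓜` restricted and the embedding `j`, is a vacuum Cauchy development `R` of `D'`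
(`exists_restricted_development`: `DataEmbedding.restrict`, locality of the shape tensor and of
the Ricci tensor), so `D'` has a maximal development `M` (the named fact, through
`exists_isMaximal_of_nonempty_of_choquetBruhatGeroch`) and `θ : R → M` by maximality. The pair
`(U, ψ) = (θ(R), θ⁻¹)` is a realised common sub-development of `M` and the spacetime `𝓜` over `j`
(`exists_realised_into`, part 1) with `ψ(U) = W`. A cluster point `q` of `ψ` along `U` at a point
of `∂U` would be a corresponding boundary pair, excluded by
`LorentzianMetric.false_of_corresponding` (`HypersurfaceCorrespondingBoundary`: the shadow of `q`
on `S` is compact, so every endless causal curve from `q` meets `S` and `q ∈ W = ψ(U)` by (DoD),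
absurd for the injective open `ψ`); its transport inputs are the pull-backs of timelike segments
along the injective local isometries `θ` and `W ↪ 𝓜` (`IsFutureTimelikeCurveOn.invFun_comp`),
its global-hyperbolicity inputs are theorems of the tree. Hence the gluing `Z = 𝓜 ∪_ψ M` is a
vacuum Cauchy development of the datum of `𝓜` receiving `M` by `j'` with `j' = jZ ∘ ψ` on `U`
(`VacuumCauchyDevelopment.exists_hypersurface_extension_of_not_clusterPt`, the timelike form of
the domain-of-dependence property of `W` coming from the Cauchy property of `S` in `W` by lifting
pieces of endless timelike curves into `W`, `exists_lift_isEndlessTimelikeCurve`). Maximality of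
`𝓜` gives `ζ : Z → 𝓜`; `ζ ∘ jZ : 𝓜 → 𝓜` fixes `ι_X`, so it is the identity (rigidity,
`DataEmbedding.eq_id_of_comp_embed_eq'`), and `χ = ζ ∘ j'` satisfies
`χ ∘ ι_M = ζ ∘ jZ ∘ ψ ∘ ι_M = j`.

No definitions, no new named facts; the two hypotheses are displayed.
-/

noncomputable section

set_option linter.dupNamespace false

open Function Set Filter Topology TopologicalSpace Bundle
open scoped Manifold ContDiff Topology

namespace Summit.FinalStateConjecture.FinalStateConjecture.Theorems.CaptureSufficesC2.Sketch

open Literature.Geometry.Lorentzian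
open Summit.FinalStateConjecture.FinalStateConjecture.Theorems

namespace HypersurfaceMGHDRealised

/-! ### The region `W` as a vacuum Cauchy development of the hypersurface datum -/

/-- **The domain of dependence as a development of the hypersurface datum** (Hawking–Ellis 1973,
§7.6, p. 250: "`D(𝓗)` with the induced structures is a development of `𝓗`"; Sbierski 2016,
Def. 2.4 for sub-developments realised as open subsets). Let `𝓜` be a vacuum Cauchy development,
`j : N → 𝓜` a smooth embedding with future unit normal `ν` inducing the data `D'` on `N`, and
`W ⊇ j(N)` an open connected region in which `j(N)` is a Cauchy hypersurface. Then
`R = (W, g|_W, τ|_W, j, ν)` is a vacuum Cauchy development of `D'` (`DataEmbedding.restrict`: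
the induced metric, the shape tensor and the Ricci tensor are local), and the inclusion
`k : R → 𝓜` is a smooth injective isometric time-orientation preserving immersion with
`k ∘ ι_R = j` and `k(R) = W`. [cite: HawkingEllis1973CUP, §7.6, p. 250] -/
theorem exists_restricted_development
    {X : Type} [TopologicalSpace X] [ChartedSpace E3 X] [IsManifold (𝓡 3) ∞ X] [ConnectedSpace X]
    {D : InitialDataSet (𝓡 3) X} (𝓜 : VacuumCauchyDevelopment D)
    {N : Type} [TopologicalSpace N] [ChartedSpace E3 N] [IsManifold (𝓡 3) ∞ N] [ConnectedSpace N]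
    {D' : InitialDataSet (𝓡 3) N} {j : N → 𝓜.carrier} {ν : NormalField (𝓡 4) j}
    (hj : Manifold.IsSmoothEmbedding (𝓡 3) (𝓡 4) ∞ j)
    (hν : 𝓜.metric.IsFutureUnitNormal (𝓡 3) 𝓜.timeOrientation j ν)
    (hh : ∀ y : N, pullbackBilin (I := 𝓡 4) (I' := 𝓡 3) j 𝓜.metric.val y = D'.h.inner y)
    (hk : ∀ [𝓜.metric.toPseudoRiemannianMetric.HasLeviCivita] (y : N),
      𝓜.metric.toPseudoRiemannianMetric.secondFundamentalForm (𝓡 3) j ν y = D'.kBilin y)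
    {W : Opens 𝓜.carrier} (hjW : range j ⊆ W) (hWc : IsConnected (W : Set 𝓜.carrier))
    (hWC : (𝓜.metric.restrict PseudoRiemannianMetric.contMDiff_restrict_holds W).IsCauchyHypersurface
      (𝓜.timeOrientation.restrict PseudoRiemannianMetric.contMDiff_restrict_holds
        𝓜.timeOrientation.contMDiff_restrict_holds W) (Subtype.val ⁻¹' range j)) :
    ∃ (R : VacuumCauchyDevelopment D') (k : R.carrier → 𝓜.carrier),
      ContMDiff (𝓡 4) (𝓡 4) ∞ k ∧
      R.metric.IsIsometricImmersion 𝓜.metric.toPseudoRiemannianMetric k ∧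
      R.timeOrientation.PreservesTimeOrientation k 𝓜.timeOrientation ∧ Injective k ∧
      k ∘ R.embed = j ∧ range k = (W : Set 𝓜.carrier) := by
  -- the data embedding `(𝓜, j, ν)` of `D'`
  let 𝒮 : DataEmbedding D' :=
    { toSpacetime := 𝓜.toSpacetime
      embed := j
      isSmoothEmbedding := hj
      normal := ν
      isFutureUnitNormal := hν
      induced_h := hh
      induced_k := hk }
  have hjW' : ∀ x, 𝒮.embed x ∈ W := fun x ↦ hjW ⟨x, rfl⟩
  have hνd : ∀ x, MDifferentiableAt (𝓡 3) (𝓡 4).tangent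
      (fun x ↦ (TotalSpace.mk' (EuclideanSpace ℝ (Fin 4)) (𝒮.embed x) (𝒮.normal x) :
        TangentBundle (𝓡 4) 𝒮.carrier)) x := fun x ↦ 𝒮.mdifferentiableAt_embed_normal x
  have hWC' : (𝒮.metric.restrict PseudoRiemannianMetric.contMDiff_restrict_holds W).IsCauchyHypersurface
      (𝒮.timeOrientation.restrict PseudoRiemannianMetric.contMDiff_restrict_holds
        𝒮.timeOrientation.contMDiff_restrict_holds W) (range (𝒮.embedOpens W hjW')) := by
    intro γ s hγ
    obtain ⟨t, ⟨hts, u, hu⟩, huniq⟩ := hWC γ s hγ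
    refine ⟨t, ⟨hts, u, Subtype.ext hu⟩, fun t' ht' ↦ huniq t' ⟨ht'.1, ?_⟩⟩
    obtain ⟨u', hu'⟩ := ht'.2
    exact ⟨u', congrArg Subtype.val hu'⟩
  let R : VacuumCauchyDevelopment D' :=
    { toDataEmbedding := 𝒮.restrict W hWc hjW' hνd
      isCauchyHypersurface := hWC'
      isRicciFlat := by
        intro inst
        haveI : (𝒮.metric.restrict PseudoRiemannianMetric.contMDiff_restrict_holds
            W).toPseudoRiemannianMetric.HasLeviCivita := inst
        exact 𝒮.isRicciFlat_restrict W 𝓜.isVacuum }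
  refine ⟨R, Subtype.val, contMDiff_subtype_val, ⟨contMDiff_subtype_val, fun y ↦ ?_⟩,
    fun y ↦ ?_, Subtype.val_injective, rfl, ?_⟩
  · ext v w
    rw [pullbackBilin_apply]
    change 𝓜.metric.val y.1 (mfderiv (𝓡 4) (𝓡 4) (Subtype.val : W → 𝓜.carrier) y v)
      (mfderiv (𝓡 4) (𝓡 4) (Subtype.val : W → 𝓜.carrier) y w) = 𝓜.metric.val y.1 v w
    rw [mfderiv_subtypeVal]
    rfl
  · change 𝓜.timeOrientation.IsFutureDirected
      (mfderiv (𝓡 4) (𝓡 4) (Subtype.val : W → 𝓜.carrier) y (𝓜.timeOrientation.vectorField y.1))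
    rw [mfderiv_subtypeVal]
    exact 𝓜.timeOrientation.isFutureDirected_vectorField y.1
  · ext z
    exact ⟨fun ⟨y, hy⟩ ↦ hy ▸ y.2, fun hz ↦ ⟨⟨z, hz⟩, rfl⟩⟩

/-! ### The stub at one hypersurface, from the named fact and a domain-of-dependence region -/

/-- **Stub S2 at one hypersurface, from Choquet-Bruhat–Geroch existence and a region `W` with
the domain-of-dependence properties** (the workhorse of the conditional closures below): let
`𝓜` be a MAXIMAL vacuum Cauchy development, `j : N → 𝓜` a smooth embedding with future unit
normal `ν` inducing `D'`, `j(N)` acausal, and `W ⊇ j(N)` an open connected region in which `j(N)`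
is a Cauchy hypersurface and which contains every `q ∈ I⁺(j N)` (resp. `I⁻(j N)`) all of whose
past-endless (resp. future-endless) causal curves meet `j(N)` (O'Neill 1983, Def. 14.35,
Lemma 14.43: `W = D(j N)`). Under the named fact `choquetBruhat_geroch_exists_mghd_cauchy`, `D'`
has a maximal vacuum Cauchy development realised inside `𝓜` by a smooth isometric
time-orientation preserving open embedding `χ` with `χ ∘ ι' = j`. See the module docstring for
the proof. [cite: HawkingEllis1973CUP, §7.6, pp. 249–251]
[cite: ChoquetBruhatGeroch1969CMP, Thm. 3 and p. 334] -/
theorem realised_of_region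
    (hcbg : Literature.Geometry.Lorentzian.choquetBruhat_geroch_exists_mghd_cauchy)
    {X : Type} [TopologicalSpace X] [ChartedSpace E3 X] [IsManifold (𝓡 3) ∞ X] [ConnectedSpace X]
    {D : InitialDataSet (𝓡 3) X} (𝓜 : VacuumCauchyDevelopment D) (hmax : 𝓜.IsMaximal)
    {N : Type} [TopologicalSpace N] [ChartedSpace E3 N] [IsManifold (𝓡 3) ∞ N] [ConnectedSpace N]
    {D' : InitialDataSet (𝓡 3) N} {j : N → 𝓜.carrier} {ν : NormalField (𝓡 4) j}
    (hj : Manifold.IsSmoothEmbedding (𝓡 3) (𝓡 4) ∞ j)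
    (hν : 𝓜.metric.IsFutureUnitNormal (𝓡 3) 𝓜.timeOrientation j ν)
    (hh : ∀ y : N, pullbackBilin (I := 𝓡 4) (I' := 𝓡 3) j 𝓜.metric.val y = D'.h.inner y)
    (hk : ∀ [𝓜.metric.toPseudoRiemannianMetric.HasLeviCivita] (y : N),
      𝓜.metric.toPseudoRiemannianMetric.secondFundamentalForm (𝓡 3) j ν y = D'.kBilin y)
    (hac : ∀ p ∈ Set.range j, ∀ q ∈ Set.range j,
      q ∈ 𝓜.metric.causalFuture 𝓜.timeOrientation {p} → q = p)
    {W : Opens 𝓜.carrier} (hjW : range j ⊆ W) (hWc : IsConnected (W : Set 𝓜.carrier))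
    (hWC : (𝓜.metric.restrict PseudoRiemannianMetric.contMDiff_restrict_holds W).IsCauchyHypersurface
      (𝓜.timeOrientation.restrict PseudoRiemannianMetric.contMDiff_restrict_holds
        𝓜.timeOrientation.contMDiff_restrict_holds W) (Subtype.val ⁻¹' range j))
    (hDp : ∀ q ∈ 𝓜.metric.chronologicalFuture 𝓜.timeOrientation (Set.range j),
      (∀ (α : ℝ → 𝓜.carrier) (s : Set ℝ), s.OrdConnected →
        𝓜.metric.IsFutureCausalCurveOn 𝓜.timeOrientation α s → IsPastEndless α s →
        ∀ t₀ ∈ s, α t₀ = q → ∃ t ∈ s, t ≤ t₀ ∧ α t ∈ Set.range j) → q ∈ W)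
    (hDm : ∀ q ∈ 𝓜.metric.chronologicalPast 𝓜.timeOrientation (Set.range j),
      (∀ (α : ℝ → 𝓜.carrier) (s : Set ℝ), s.OrdConnected →
        𝓜.metric.IsFutureCausalCurveOn 𝓜.timeOrientation α s → IsFutureEndless α s →
        ∀ t₀ ∈ s, α t₀ = q → ∃ t ∈ s, t₀ ≤ t ∧ α t ∈ Set.range j) → q ∈ W) :
    ∃ 𝒟' : VacuumCauchyDevelopment D', 𝒟'.IsMaximal ∧
      ∃ χ : 𝒟'.carrier → 𝓜.carrier, ContMDiff (𝓡 4) (𝓡 4) ∞ χ ∧ Topology.IsOpenEmbedding χ ∧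
        𝒟'.metric.IsIsometricImmersion 𝓜.metric.toPseudoRiemannianMetric χ ∧
        𝒟'.timeOrientation.PreservesTimeOrientation χ 𝓜.timeOrientation ∧ χ ∘ 𝒟'.embed = j := by
  classical
  have hn2 : (2 : ℕ∞ω) ≤ ∞ := WithTop.coe_le_coe.mpr le_top
  -- `N` is Hausdorff and second countable (embedded in `𝓜`)
  haveI : T2Space N := hj.isEmbedding.t2Space
  haveI : SecondCountableTopology N := hj.isEmbedding.secondCountableTopology
  -- `j(N)` is achronal
  have hachr : ∀ p ∈ range j, ∀ q ∈ range j,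
      q ∉ 𝓜.metric.chronologicalFuture 𝓜.timeOrientation {p} := by
    intro p hp q hq hpq
    have hqp : q = p :=
      hac p hp q hq (LorentzianMetric.chronologicalFuture_subset_causalFuture _ _ _ hpq)
    subst hqp
    obtain ⟨z, hz, γ, a, b, hab, hγ, hγa, hγb⟩ := hpq
    rw [mem_singleton_iff] at hz
    exact 𝓜.toCauchyDevelopment.isChronological γ a b hab hγ (by rw [hγa, hγb, hz])
  -- `W` as a vacuum Cauchy development `R` of `D'`, with its inclusion `k`
  obtain ⟨R, k, hks, hki, hkt, hkinj, hkc, hkW⟩ :=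
    exists_restricted_development 𝓜 hj hν hh hk hjW hWc hWC
  haveI : Nonempty R.carrier := inferInstance
  have hkd : MDifferentiable (𝓡 4) (𝓡 4) k := hks.mdifferentiable (by simp)
  have hkloc : IsLocalDiffeomorph (𝓡 4) (𝓡 4) ∞ k :=
    LorentzianMetric.isLocalDiffeomorph_of_isIsometricImmersion hki
  -- a maximal development `M` of `D'` (the named fact) and `θ : R → M`
  obtain ⟨M, hM⟩ := exists_isMaximal_of_nonempty_of_choquetBruhatGeroch hcbg N D' ⟨R⟩
  obtain ⟨θ, hθs, hθo, hθi, hθt, hθc⟩ := hM R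
  have hθloc : IsLocalDiffeomorph (𝓡 4) (𝓡 4) ∞ θ :=
    LorentzianMetric.isLocalDiffeomorph_of_isIsometricImmersion hθi
  -- realise `R` inside `M` through `θ`: `(U, ψ) = (θ(R), k ∘ θ⁻¹)`
  obtain ⟨U, ψ, hP, hUeq, hinj, hψθ⟩ := exists_realised_into R.toCauchyDevelopment
    M.toCauchyDevelopment 𝓜.toSpacetime j hθs hθo hθi hθt hθc hks hki hkt hkc hkinj
  have hι : ∀ u, M.embed u ∈ U := hP.1
  have hUC := hP.2.2.1
  have hψs : ContMDiffOn (𝓡 4) (𝓡 4) ∞ ψ U := hP.2.2.2.1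
  have hψc : ψ ∘ M.embed = j := hP.2.2.2.2.2.2
  -- `ψ(U) = W`
  have himage : ψ '' (U : Set M.carrier) = (W : Set 𝓜.carrier) := by
    rw [hUeq, ← hkW]
    ext z
    constructor
    · rintro ⟨_, ⟨r, rfl⟩, rfl⟩
      exact ⟨r, (hψθ r).symm⟩
    · rintro ⟨r, rfl⟩
      exact ⟨θ r, ⟨r, rfl⟩, hψθ r⟩
  have hψW : MapsTo ψ (U : Set M.carrier) (W : Set 𝓜.carrier) := fun x hx ↦ by
    have h : ψ x ∈ ψ '' (U : Set M.carrier) := mem_image_of_mem ψ hx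
    rwa [himage] at h
  have hWψ : (W : Set 𝓜.carrier) ⊆ ψ '' (U : Set M.carrier) := by rw [himage]
  have hS₁U : range M.embed ⊆ (U : Set M.carrier) := by
    rintro _ ⟨u, rfl⟩
    exact hι u
  have hψS : ψ '' range M.embed = range j := by rw [← range_comp, hψc]
  -- `ψ` maps open subsets of `U` to open sets
  have hopen : ∀ B : Set M.carrier, IsOpen B → IsOpen (ψ '' (B ∩ (U : Set M.carrier))) := by
    intro B hB
    have heq : ψ '' (B ∩ (U : Set M.carrier)) = k '' (θ ⁻¹' B) := by
      rw [hUeq]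
      ext z
      constructor
      · rintro ⟨_, ⟨hb, r, rfl⟩, rfl⟩
        exact ⟨r, hb, (hψθ r).symm⟩
      · rintro ⟨r, hr, rfl⟩
        exact ⟨θ r, ⟨hr, r, rfl⟩, hψθ r⟩
    rw [heq]
    exact hkloc.isLocalHomeomorph.isOpenMap _ (hB.preimage hθs.continuous)
  -- `ψ` pushes timelike segments of `M` inside `U` forward
  have hpush : ∀ ⦃γ : ℝ → M.carrier⦄ ⦃a b : ℝ⦄, a < b →
      M.metric.IsFutureTimelikeCurveOn M.timeOrientation γ (Icc a b) →
      (∀ t ∈ Icc a b, γ t ∈ U) →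
      ψ (γ b) ∈ 𝓜.metric.chronologicalFuture 𝓜.timeOrientation {ψ (γ a)} := by
    intro γ a b hab hγ hγU
    have hγU' : ∀ t ∈ Icc a b, γ t ∈ range θ := fun t ht ↦ by
      rw [← hUeq]; exact hγU t ht
    have hδ := hγ.invFun_comp hθi hθt hθo.injective hθloc hγU'
    have hkδ : 𝓜.metric.IsFutureTimelikeCurveOn 𝓜.timeOrientation (k ∘ (invFun θ ∘ γ))
        (Icc a b) := hδ.comp_isIsometricImmersion hkd hkt hki.2
    have hend : ∀ t ∈ Icc a b, ψ (γ t) = (k ∘ (invFun θ ∘ γ)) t := fun t ht ↦ by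
      have h := hψθ ((invFun θ ∘ γ) t)
      rwa [show θ ((invFun θ ∘ γ) t) = γ t from invFun_eq (hγU' t ht)] at h
    rw [hend a (left_mem_Icc.2 hab.le), hend b (right_mem_Icc.2 hab.le)]
    exact ⟨_, rfl, k ∘ (invFun θ ∘ γ), a, b, hab, hkδ, rfl, rfl⟩
  -- `ψ⁻¹` pulls timelike segments of `𝓜` inside `W` back
  have hpull : ∀ ⦃γ : ℝ → 𝓜.carrier⦄ ⦃a b : ℝ⦄, a < b →
      𝓜.metric.IsFutureTimelikeCurveOn 𝓜.timeOrientation γ (Icc a b) →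
      (∀ t ∈ Icc a b, γ t ∈ W) → ∀ ⦃x y : M.carrier⦄, x ∈ U → y ∈ U → γ a = ψ x → γ b = ψ y →
      y ∈ M.metric.chronologicalFuture M.timeOrientation {x} := by
    intro γ a b hab hγ hγW x y hx hy hγa hγb
    have hγW' : ∀ t ∈ Icc a b, γ t ∈ range k := fun t ht ↦ by rw [hkW]; exact hγW t ht
    have hδ := hγ.invFun_comp hki hkt hkinj hkloc hγW'
    have hθδ : M.metric.IsFutureTimelikeCurveOn M.timeOrientation (θ ∘ (invFun k ∘ γ))
        (Icc a b) := hδ.comp_isIsometricImmersion (hθs.mdifferentiable (by simp)) hθt hθi.2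
    have hxU : x ∈ range θ := by rw [← hUeq]; exact hx
    have hyU : y ∈ range θ := by rw [← hUeq]; exact hy
    obtain ⟨rx, rfl⟩ := hxU
    obtain ⟨ry, rfl⟩ := hyU
    have hxa : (invFun k ∘ γ) a = rx := by
      show invFun k (γ a) = rx
      rw [hγa, hψθ]
      exact leftInverse_invFun hkinj rx
    have hyb : (invFun k ∘ γ) b = ry := by
      show invFun k (γ b) = ry
      rw [hγb, hψθ]
      exact leftInverse_invFun hkinj ry
    refine ⟨θ rx, rfl, θ ∘ (invFun k ∘ γ), a, b, hab, hθδ, ?_, ?_⟩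
    · show θ ((invFun k ∘ γ) a) = θ rx
      rw [hxa]
    · show θ ((invFun k ∘ γ) b) = θ ry
      rw [hyb]
  -- `W ⊆ D̃(j N)`: every endless timelike curve of `𝓜` through a point of `ψ(U)` meets `j(N)`
  have hDt : ∀ x ∈ U, ∀ (γ : ℝ → 𝓜.carrier) (s : Set ℝ),
      𝓜.metric.IsEndlessTimelikeCurve 𝓜.timeOrientation γ s → (∃ t ∈ s, γ t = ψ x) →
      ∃ t ∈ s, γ t ∈ range j := by
    rintro x hx γ s hγ ⟨t₀, ht₀, hγt₀⟩
    have hW₀ : γ t₀ ∈ range k := by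
      rw [hkW, hγt₀]
      exact hψW hx
    obtain ⟨δ, hδγ, hδ⟩ := LorentzianMetric.exists_lift_isEndlessTimelikeCurve R.timeOrientation
      𝓜.timeOrientation hki hkt hkinj hkloc hγ ht₀ hW₀
    obtain ⟨t, ⟨htJ, u, hu⟩, -⟩ := R.isCauchyHypersurface δ _ hδ
    refine ⟨t, (connectedComponentIn_subset _ _ htJ).1, u, ?_⟩
    rw [← hδγ t htJ, ← hu]
    exact (congrFun hkc u).symm
  -- no cluster point of `ψ` along `U` at `∂U` (no corresponding boundary points)
  have hncb : ∀ p ∈ frontier (U : Set M.carrier), ∀ q : 𝓜.carrier,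
      ¬ ClusterPt q (map ψ (𝓝[(U : Set M.carrier)] p)) := by
    intro p hp q hq
    have hcorr : ∀ V ∈ 𝓝 p, ∀ V' ∈ 𝓝 q, ∃ y ∈ (U : Set M.carrier), y ∈ V ∧ ψ y ∈ V' := by
      intro V hV V' hV'
      have hmem : ψ '' (V ∩ (U : Set M.carrier)) ∈ map ψ (𝓝[(U : Set M.carrier)] p) :=
        image_mem_map (Filter.inter_mem (mem_nhdsWithin_of_mem_nhds hV) self_mem_nhdsWithin)
      obtain ⟨z, hzV', y, ⟨hyV, hyU⟩, rfl⟩ := (clusterPt_iff_nonempty.1 hq) hV' hmem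
      exact ⟨y, hyU, hyV, hzV'⟩
    exact LorentzianMetric.false_of_corresponding hn2 hn2
      PseudoRiemannianMetric.contMDiff_restrict_holds M.timeOrientation.contMDiff_restrict_holds
      PseudoRiemannianMetric.contMDiff_restrict_holds 𝓜.timeOrientation.contMDiff_restrict_holds
      M.isCauchyHypersurface hS₁U hUC hachr hWC hψW hWψ hψs.continuousOn hinj hopen hψS
      hpush hpull
      M.isCompact_causalPast_inter_causalFuture_range
      M.isCompact_causalFuture_inter_causalPast_range
      (fun hx hy hxy ↦ 𝓜.toCauchyDevelopment.mem_causalFuture_of_tendsto hx hy hxy)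
      (fun C hC x ↦ 𝓜.toCauchyDevelopment.isCompact_causalFuture_inter_causalPast_of_isCompact hC x)
      (fun C hC x ↦ 𝓜.toCauchyDevelopment.isCompact_causalPast_inter_causalFuture_of_isCompact hC x)
      (fun K hK γ s hs hγ hend t₀ ht₀ ↦
        𝓜.toCauchyDevelopment.exists_le_notMem_of_isPastEndless hK hs hγ hend ht₀)
      (fun K hK γ s hs hγ hend t₀ ht₀ ↦
        𝓜.toCauchyDevelopment.exists_ge_notMem_of_isFutureEndless hK hs hγ hend ht₀)
      (LorentzianMetric.causalFuture_subset_union_chronologicalFuture_of_cauchy_nhds hn2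
        PseudoRiemannianMetric.contMDiff_restrict_holds 𝓜.timeOrientation.contMDiff_restrict_holds
        𝓜.toCauchyDevelopment.isCausallyWellBehaved hac hjW hWC)
      (LorentzianMetric.causalPast_subset_union_chronologicalPast_of_cauchy_nhds hn2
        PseudoRiemannianMetric.contMDiff_restrict_holds 𝓜.timeOrientation.contMDiff_restrict_holds
        𝓜.toCauchyDevelopment.isCausallyWellBehaved hac hjW hWC)
      hDp hDm hp hcorr
  -- the gluing `Z = 𝓜 ∪_ψ M`, receiving `M` by `j'`
  obtain ⟨Z, jZ, j', ⟨hjZs, -, hjZi, hjZt, hjZc⟩, ⟨hj's, hj'o, hj'i, hj't⟩, hcompat⟩ :=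
    VacuumCauchyDevelopment.exists_hypersurface_extension_of_not_clusterPt M 𝓜 j hachr U ψ hP
      hinj hDt hncb
  -- maximality of `𝓜` absorbs `Z`; rigidity makes `ζ ∘ jZ` the identity
  obtain ⟨ζ, hζs, hζo, hζi, hζt, hζc⟩ := hmax Z
  have hζd : MDifferentiable (𝓡 4) (𝓡 4) ζ := hζs.mdifferentiable (by simp)
  have hid : ζ ∘ jZ = id :=
    𝓜.toDataEmbedding.eq_id_of_comp_embed_eq' (hζi.comp hjZi)
      (hζt.comp hjZt hζi.2 hζd (hjZs.mdifferentiable (by simp)))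
      (by rw [comp_assoc, hjZc]; exact hζc)
  refine ⟨M, hM, ζ ∘ j', hζs.comp hj's, hζo.comp hj'o, hζi.comp hj'i,
    hζt.comp hj't hζi.2 hζd (hj's.mdifferentiable (by simp)), ?_⟩
  funext u
  show ζ (j' (M.embed u)) = j u
  rw [hcompat _ (hι u), show ψ (M.embed u) = j u from congrFun hψc u]
  exact congrFun hid (j u)


end HypersurfaceMGHDRealised

open HypersurfaceMGHDRealised

/-! ### The registered conditional form -/

/-- **Registered sub-goal `stub_hypersurfaceMGHDRealised_of_dodRegion`**: the registered statement
of `stub_hypersurfaceMGHDRealised` from the named fact `choquetBruhat_geroch_exists_mghd_cauchy`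
(Choquet-Bruhat–Geroch 1969, Thm. 3) and the displayed domain-of-dependence statement (DoD) for the
acausal spacelike hypersurface `S = j(N)` of a vacuum Cauchy development `𝓜` — an open connected
region `V ⊇ S` in which `S` is a Cauchy hypersurface, contained in the timelike domain of
dependence of `S` and containing every `q ∈ I±(S)` all of whose past/future-endless causal curves
meet `S` (O'Neill 1983, Def. 14.35 and Lemma 14.43: `V = D(S)`). One line over
`HypersurfaceMGHDRealised.realised_of_region`. [cite: HawkingEllis1973CUP, §7.6, pp. 249–251]
[cite: ChoquetBruhatGeroch1969CMP, Thm. 3 and p. 334] -/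
theorem stub_hypersurfaceMGHDRealised_of_dodRegion : (choquetBruhat_geroch_exists_mghd_cauchy) → (∀ (X : Type) [TopologicalSpace X] [ChartedSpace E3 X] [IsManifold (𝓡 3) ∞ X] [T2Space X] [SecondCountableTopology X] [ConnectedSpace X] (D : InitialDataSet (𝓡 3) X) (𝓜 : VacuumCauchyDevelopment D), ∀ (N : Type) [TopologicalSpace N] [ChartedSpace E3 N] [IsManifold (𝓡 3) ∞ N] [ConnectedSpace N] (D' : InitialDataSet (𝓡 3) N) (j : N → 𝓜.carrier) (ν : NormalField (𝓡 4) j), Manifold.IsSmoothEmbedding (𝓡 3) (𝓡 4) ∞ j → 𝓜.metric.IsFutureUnitNormal (𝓡 3) 𝓜.timeOrientation j ν → (∀ y : N, pullbackBilin (I := 𝓡 4) (I' := 𝓡 3) j 𝓜.metric.val y = D'.h.inner y) → (∀ [𝓜.metric.toPseudoRiemannianMetric.HasLeviCivita] (y : N), 𝓜.metric.toPseudoRiemannianMetric.secondFundamentalForm (𝓡 3) j ν y = D'.kBilin y) → (∀ p ∈ Set.range j, ∀ q ∈ Set.range j, q ∈ 𝓜.metric.causalFuture 𝓜.timeOrientation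 {p} → q = p) → ∃ V : TopologicalSpace.Opens 𝓜.carrier, IsConnected (V : Set 𝓜.carrier) ∧ (∀ u, j u ∈ V) ∧ (𝓜.metric.restrict PseudoRiemannianMetric.contMDiff_restrict_holds V).IsCauchyHypersurface (𝓜.timeOrientation.restrict PseudoRiemannianMetric.contMDiff_restrict_holds 𝓜.timeOrientation.contMDiff_restrict_holds V) (Subtype.val ⁻¹' Set.range j) ∧ (∀ x ∈ V, ∀ (γ : ℝ → 𝓜.carrier) (s : Set ℝ), 𝓜.metric.IsEndlessTimelikeCurve 𝓜.timeOrientation γ s → (∃ t ∈ s, γ t = x) → ∃ t ∈ s, γ t ∈ Set.range j) ∧ (∀ q ∈ 𝓜.metric.chronologicalFuture 𝓜.timeOrientation (Set.range j), (∀ (α : ℝ → 𝓜.carrier) (s : Set ℝ), s.OrdConnected → 𝓜.metric.IsFutureCausalCurveOn 𝓜.timeOrientation α s → IsPastEndless α s → ∀ t₀ ∈ s, α t₀ = q → ∃ t ∈ s, t ≤ t₀ ∧ α t ∈ Set.range j) → q ∈ V) ∧ (∀ q ∈ 𝓜.metric.chronologicalPast 𝓜.timeOrientation (Set.range j), (∀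 (α : ℝ → 𝓜.carrier) (s : Set ℝ), s.OrdConnected → 𝓜.metric.IsFutureCausalCurveOn 𝓜.timeOrientation α s → IsFutureEndless α s → ∀ t₀ ∈ s, α t₀ = q → ∃ t ∈ s, t₀ ≤ t ∧ α t ∈ Set.range j) → q ∈ V)) → ∀ (X : Type) [TopologicalSpace X] [ChartedSpace E3 X] [IsManifold (𝓡 3) ∞ X] [T2Space X] [SecondCountableTopology X] [ConnectedSpace X] (D : InitialDataSet (𝓡 3) X) (𝓜 : VacuumCauchyDevelopment D), 𝓜.IsMaximal → ∀ (N : Type) [TopologicalSpace N] [ChartedSpace E3 N] [IsManifold (𝓡 3) ∞ N] [ConnectedSpace N] (D' : InitialDataSet (𝓡 3) N) (j : N → 𝓜.carrier) (ν : NormalField (𝓡 4) j), Manifold.IsSmoothEmbedding (𝓡 3) (𝓡 4) ∞ j → 𝓜.metric.IsFutureUnitNormal (𝓡 3) 𝓜.timeOrientation j ν → (∀ y : N, pullbackBilin (I := 𝓡 4) (I' := 𝓡 3) j 𝓜.metric.val y = D'.h.inner y) → (∀ [𝓜.metric.toPseudoRiemannianMetric.HasLeviCivita] (y : N), 𝓜.metric.toPseudoRiemannianMetric.secondFundamentalForm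 (𝓡 3) j ν y = D'.kBilin y) → (∀ p ∈ Set.range j, ∀ q ∈ Set.range j, q ∈ 𝓜.metric.causalFuture 𝓜.timeOrientation {p} → q = p) → ∃ 𝒟' : VacuumCauchyDevelopment D', 𝒟'.IsMaximal ∧ ∃ χ : 𝒟'.carrier → 𝓜.carrier, ContMDiff (𝓡 4) (𝓡 4) ∞ χ ∧ Topology.IsOpenEmbedding χ ∧ 𝒟'.metric.IsIsometricImmersion 𝓜.metric.toPseudoRiemannianMetric χ ∧ 𝒟'.timeOrientation.PreservesTimeOrientation χ 𝓜.timeOrientation ∧ χ ∘ 𝒟'.embed = j :=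
  fun hcbg hdod X _ _ _ _ _ _ D 𝓜 hmax N _ _ _ _ D' j ν hj hν hh hk hac ↦ by
    obtain ⟨V, hVc, hjV, hVC, -, hDp, hDm⟩ := hdod X D 𝓜 N D' j ν hj hν hh hk hac
    exact realised_of_region hcbg 𝓜 hmax hj hν hh hk hac (by rintro _ ⟨u, rfl⟩; exact hjV u)
      hVc hVC hDp hDm

end Summit.FinalStateConjecture.FinalStateConjecture.Theorems.CaptureSufficesC2.Sketch

end
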